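import Summits.BirchSwinnertonDyer.BirchSwinnertonDyer.Theorems.KimAtThreePortSharedC3Pair
import Summits.BirchSwinnertonDyer.Rank1Residual.GaloisImage.KatoKuriharaPortThreeOfZetaBodyBad
import Summits.BirchSwinnertonDyer.Rank1Residual.GaloisImage.KatoKuriharaPortThreeOfZetaBodyOfValueRows
import HarnessLib

/-!
# ★ PK-6₂ with THEOREM D's `hbad` REPLACED by the displayed local clause at the anomalous bad places:
# PORT″ `KatoKuriharaPortThreeAtWith₂ W 0 v₃ η P` at `t = 0` from Kato's Euler system on EVERY row
# (cell `bsd-addord`, seat w2-acc4 gen 0; route W2 `KimAtThreeKolyvagin`, crux 19560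
# `KatoKuriharaPortThreeShared`, residual (C3) — kernel side, END level)

n1011-p13's ★ PK-6₂ (`GaloisImage.katoKuriharaPortThreeAtWith₂_zero_of_zetaBody`) reaches PORT″ at a
`t = 0` row from Kato's `ZetaBody`, the riders `hfin`, `hcdA`, THEOREM D's certificates `ht0` and `hbad`
(NO anomalous bad place) and the value rows.  THIS FILE deletes `hbad`: in its place the END takes the
DISPLAYED local clause `hloc` — for every depth `j` and every `ℤ₃`-linear coefficient model
`(T′, red, e)` of `E[3^{j+1}]` (pinned by `π_{j+1} = e ∘ red`), every global transport `Ψ` computed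
on cocycles by `e`, every generator family `σ` (`σ_q ∈ I_q`, `χ_q(σ_q) = η_q`), every level `r` of
usable primes and every class `κ ∈ H¹_cont(Γ_ℚ, T′)` with `res_{U_r} κ = D_r (red_* z_{⊥,r})`
(`z` = Kato's classes of the `ZetaBody` family): at every bad `w ≠ 3`, `w ∉ r`, with `E(ℚ_w)[3] ≠ 0`,
`loc_w (Ψ κ) ∈ propagatedSelmerStructure W 3 j (inr w)` — i.e. [Ru00] Thm. 4.5.1 / [MR04] Prop. A.2
+ Remark A.5 READ for the tree's tame derivative classes of Kato's system (the seat's pair-level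
socket `KimAtThreePortSharedC3Pair.exists_isKolyvaginSystem_pair_propagatedSelmerStructure_of_localCondition`,
p468462).  The clause is the exact junction where either kernel road under construction in the cell
plugs in: w2-c3 g5's unramified-integrality bridge
`KimAtThreeDeepUpperBadPlaceCondition.localization_mem_propagatedSelmerStructure_three_of_unramified`
(n1011-p15 T-DER-BU U1–U5; input: Kato's classes unramified above `w`, Kato (8.1.3)) or acc5's
universal-norm road (`KimAtThreePortSharedC3NormCoboundary` / `…NormTower`; input: `cores_p`).

* `katoKuriharaPortThreeAtWith₂_zero_of_zetaBody_of_localCondition` — ★ PK-6₂'s binders with `hbad`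
  replaced by `hloc`; proof = ★ PK-6₂'s / END-b F2's (guards → `hKol`, usable primes, `𝓕_can,3 = ⊤`
  from `ht0`, the two coefficient systems `E[3^{j+1}]_{ℤ₃}` of GZ-2, the seat's pair theorem with
  `hloc` instantiated at both depths, T-PK6-GEN per level on the value rows, diagonal packaging).
* `katoKuriharaPortThreeAtWith₂_zero_of_zetaBody_of_localCondition_of_valueRows` — the same with the
  value rows discharged by n1011-p02's T-PK6-VDIS `ValueRow.valueRows_of_zetaBody`.

HONEST LIMITS: `t = 0` only; `hloc` is DISPLAYED (not proved here); nothing is booked; closes nothing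
by itself (consumer: the seat's `KimAtThreePortSharedC3OfLocalCondition`, kim3's assembly of 19560).
No definition, no named fact, no `sorry`.

References: K. Kato, Astérisque 295 (2004) §8.1 (8.1.3), §9.4, Thm. 9.7, Ex. 13.3; C.-H. Kim, AJM 148
(2026) Thm. 3.13, §3.3–§3.4.1; B. Mazur, K. Rubin, Mem. AMS 799 (2004) Def. 3.2.1, Thm. 3.2.4, App. A
(Lemma A.1, Prop. A.2, Remark A.5); K. Rubin, *Euler Systems* (2000) Def. 4.4.4, Thm. 4.5.1;
R. Sakamoto, JTNB 36 (2024) §2, Def. 4.1.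
-/

noncomputable section

set_option linter.dupNamespace false

open scoped NumberField TensorProduct ContRepresentation Classical
open CategoryTheory Field Function Finset IsDedekindDomain NumberField WeierstrassCurve
open Rat.HeightOneSpectrum
open Literature.NumberTheory.GaloisRepresentations Literature.NumberTheory.GaloisCohomology
open Literature.NumberTheory.GaloisRepresentations.DiscreteGaloisModule
open Literature.NumberTheory.EllipticCurves Literature.NumberTheory.EllipticCurves.ModularForms
open Literature.NumberTheory.EllipticCurves.Kato2004
open Literature.NumberTheory.EllipticCurves.Kato2004.EulerSystemValues
open Summit.BirchSwinnertonDyer.Rank1Residual.GaloisImage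
open Summit.BirchSwinnertonDyer.Rank1Residual.GaloisImage.TorsionCoeff
open Summit.BirchSwinnertonDyer.BirchSwinnertonDyer.Theorems.KimAtThreePortSharedC3Pair

namespace Summit.BirchSwinnertonDyer.BirchSwinnertonDyer.Theorems.KimAtThreePortSharedC3End

variable (W : WeierstrassCurve ℚ) [W.IsElliptic] [W.IsGloballyMinimal]
  [ContinuousSMul ℤ_[3] (W.tateModule 3)] [Module.Free ℤ_[3] (W.tateModule 3)]
  [Module.Finite ℤ_[3] (W.tateModule 3)]

/-- Local notation: `T∞ = T₃ E` as a continuous `G_ℚ`-representation. -/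
local notation3 "T∞" => WeierstrassCurve.tateGaloisRep W 3 (W.continuous_galoisRepTate_holds 3)

/-- Local notation: `𝐫⟦f, T′, U⟧ = f_* : H¹(U, T₃E) → H¹(U, T′)`. -/
local notation3 (prettyPrint := false) "𝐫⟦" f ", " Tg ", " U "⟧" =>
  ContinuousCohomology.map (ContinuousMonoidHom.id _)
    (X := subgroupRep (ContinuousRep.toTopRep T∞) U)
    (Y := subgroupRep (ContinuousRep.toTopRep Tg) U)
    ((TopRep.resFunctor (Subgroup.subtype U)).map f) 1

/-- Local notation: `𝐃⟦A, X, U, τ⟧ ℓ = ∑_{j < ℓ−1} j·(τ_ℓ)_*^j`, Kolyvagin's derivative operator. -/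
local notation3 (prettyPrint := false) "𝐃⟦" A ", " X ", " U ", " τ "⟧" =>
  fun ℓ : HeightOneSpectrum (𝓞 ℚ) =>
  ∑ j ∈ Finset.range (((primesEquiv ℓ : Nat.Primes) : ℕ) - 1),
    (j : Module.End A (continuousCohomology 1 (subgroupRep X U))) *
      (conjMap X U ((τ : HeightOneSpectrum (𝓞 ℚ) → absoluteGaloisGroup ℚ) ℓ) 1).hom.toLinearMap ^ j

/-- Local notation: `𝐃F⟦r, τ⟧ ℓ = Σ_{j<ℓ−1} j·σ_{χ_{m(0,r)}(τ_ℓ)}^j` on the level field `ℚ(ζ_{m(0,r)})`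
(PK-1 ★2's field-side spelling, `p = 3`). -/
local notation3 (prettyPrint := false) "𝐃F⟦" r ", " τ "⟧" =>
  fun ℓ : HeightOneSpectrum (𝓞 ℚ) =>
  ∑ j ∈ Finset.range (((primesEquiv ℓ : Nat.Primes) : ℕ) - 1),
    (j : Module.End ℚ (CyclotomicField (cycLevel 3 0 r) ℚ)) *
      (sigma (cycLevel 3 0 r) (modNCyclotomicCharacter ℚ (cycLevel 3 0 r)
          ((τ : HeightOneSpectrum (𝓞 ℚ) → absoluteGaloisGroup ℚ) ℓ)) :
        CyclotomicField (cycLevel 3 0 r) ℚ →ₐ[ℚ] CyclotomicField (cycLevel 3 0 r) ℚ).toLinearMap ^ j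

set_option backward.isDefEq.respectTransparency false in
/-- **★ PK-6₂ with `hbad` replaced by the DISPLAYED local clause `hloc` at the anomalous bad places**
(module docstring): PORT″ `KatoKuriharaPortThreeAtWith₂ W 0 v₃ η P` for every `v₃` and every
generator family `η`, from `hbody` for `P.f` at the conductor level (`hN`), the riders `hfin`,
`hcdA`, THEOREM D's `ht0`, the value rows `hvalue`, and `hloc` ([Ru00] Thm. 4.5.1 / [MR04] App. A
read for the tree's derivative classes of Kato's system; displayed, not asserted).
[cite: Kato2004Asterisque, §9.4 (p. 188), Thm. 9.7 (p. 189) and Ex. 13.3 (pp. 224–225)]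
[cite: Kim2022StructureSelmer, Thm. 3.13 and §1.2.2, §2.2.2, §3.3–§3.4.1 (arXiv v3 pp. 12, 17–18, 26–27)]
[cite: MazurRubin2004, Def. 3.1.3, Def. 3.2.1, Thm. 3.2.4 and App. A (Lemma A.1, Prop. A.2, Remark A.5)]
[cite: Rubin2000, Def. 4.4.4 and Thm. 4.5.1] [cite: Sakamoto2024, §2 and Def. 4.1] -/
theorem katoKuriharaPortThreeAtWith₂_zero_of_zetaBody_of_localCondition
    {N : ℕ} [NeZero N] (P : ModularParametrizationData W N) (hN : N = W.conductorNorm ℤ)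
    {ι : (n : ℕ) → (CyclotomicField n ℚ →+* ℂ)} {κK : ℝ}
    {Λ : ∀ (k' : ℕ) (r : Finset (HeightOneSpectrum (𝓞 ℚ))),
      H1 (tateRep W 3) (cycSubgroup 3 k' r) →ₗ[ℤ_[3]] ℚ_[3] ⊗[ℚ] CyclotomicField (cycLevel 3 k' r) ℚ}
    {c d a : ℤ} {A : ℕ}
    {z : ∀ (k' : ℕ) (r : (cyclotomicLevelsRat 3 (badPlaces c d A N)).Ideals),
      H1 (tateRep W 3) ((cyclotomicLevelsRat 3 (badPlaces c d A N)).level k' r.1)}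
    {x : ∀ (k' : ℕ) (r : (cyclotomicLevelsRat 3 (badPlaces c d A N)).Ideals),
      CyclotomicField (cycLevel 3 k' r.1) ℚ}
    (hbody : ZetaBody W 3 P.f ι κK Λ c d a A z x)
    {v₃ : HeightOneSpectrum (𝓞 ℚ)}
    (Λfin : ∀ j : ℕ, galoisCohomology ((W.torsionGaloisModule (((3 : ℕ) : ℤ) ^ j * ((3 : ℕ) : ℤ))).toLocal
      (Sum.inr v₃)) 1 →+ ZMod (3 ^ (j + 1)))
    (hfin : ∀ j : ℕ, KatoExpStarFiniteLevelAt W 3 j 0 v₃ Λ (Λfin j))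
    {η : (q : HeightOneSpectrum (𝓞 ℚ)) → (ZMod (Ideal.absNorm q.asIdeal))ˣ}
    -- the auxiliary datum avoids every prime `≡ 1 (mod 3)` (so every Kolyvagin prime is usable)
    (hcdA : ∀ q : ℕ, q.Prime → q ≡ 1 [MOD 3] → ¬ q ∣ 2 * c.natAbs * d.natAbs * A)
    -- THEOREM D's row certificate at the place `3` (`t = 0`); NO `hbad`
    (ht0 : ∀ w : HeightOneSpectrum (𝓞 ℚ), ((3 : ℕ) : 𝓞 ℚ) ∈ w.asIdeal →
        ∀ Q : (W.baseChange (w.adicCompletion ℚ)).toAffine.Point, 3 • Q = 0 → Q = 0)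
    -- the DISPLAYED local clause at the ANOMALOUS bad places, every depth `j` ([Ru00] Thm. 4.5.1 read)
    (hloc : ∀ (j : ℕ) {M' : Type} [AddCommGroup M'] [Module ℤ_[3] M'] [TopologicalSpace M']
        [DiscreteTopology M'] [IsTopologicalAddGroup M'] [ContinuousSMul ℤ_[3] M']
        {T' : GaloisRep ℚ ℤ_[3] M'} (red : (T∞).toTopRep ⟶ T'.toTopRep)
        (e : M' →+ WeierstrassCurve.geomTorsion W (((3 : ℕ) : ℤ) ^ j * ((3 : ℕ) : ℤ))),
        Continuous e →
        (∀ (g : absoluteGaloisGroup ℚ) (y : M'), e (T'.toTopRep.ρ g y) =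
          (W.torsionGaloisModule (((3 : ℕ) : ℤ) ^ j * ((3 : ℕ) : ℤ))).toTopRep.ρ g (e y)) →
        (∀ b : W.tateModule 3, tateToTorsion W 3 j b = e (red.hom b)) →
      ∀ (Ψ : continuousCohomology 1 T'.toTopRep →+
        galoisCohomology (W.torsionGaloisModule (((3 : ℕ) : ℤ) ^ j * ((3 : ℕ) : ℤ))) 1),
      (∀ (φ : contOneCocycles T'.toTopRep)
        (ψ : contOneCocycles (W.torsionGaloisModule (((3 : ℕ) : ℤ) ^ j * ((3 : ℕ) : ℤ))).toTopRep),
        (∀ g, ψ.1 g = e (φ.1 g)) → Ψ (oneCocycleClass _ φ) = oneCocycleClass _ ψ) →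
      ∀ (σ : HeightOneSpectrum (𝓞 ℚ) → absoluteGaloisGroup ℚ),
        (∀ ℓ, σ ℓ ∈ (adicCompletionPrime ℚ ℓ).inertia (absoluteGaloisGroup ℚ)) →
        (∀ ℓ, modNCyclotomicCharacter ℚ (Ideal.absNorm ℓ.asIdeal) (σ ℓ) = η ℓ) →
      ∀ (r : (cyclotomicLevelsRat 3 (badPlaces c d A N)).Ideals),
        (∀ q ∈ r.1, Kato.IsKolyvaginPrime W 3 (j + 1) ((primesEquiv q : Nat.Primes) : ℕ)) →
      ∀ (comm : ((r.1 : Finset _) : Set (HeightOneSpectrum (𝓞 ℚ))).Pairwise fun a b =>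
          Commute (𝐃⟦ℤ_[3], T'.toTopRep, ((cyclotomicLevelsRat 3 (badPlaces c d A N)).level ⊥ r.1), σ⟧ a)
            (𝐃⟦ℤ_[3], T'.toTopRep, ((cyclotomicLevelsRat 3 (badPlaces c d A N)).level ⊥ r.1), σ⟧ b))
        (κ : continuousCohomology 1 T'.toTopRep),
        resSubgroup T'.toTopRep ((cyclotomicLevelsRat 3 (badPlaces c d A N)).level ⊥ r.1) 1 κ =
          (r.1.noncommProd 𝐃⟦ℤ_[3], T'.toTopRep,
              ((cyclotomicLevelsRat 3 (badPlaces c d A N)).level ⊥ r.1), σ⟧ comm)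
            (𝐫⟦red, T', ((cyclotomicLevelsRat 3 (badPlaces c d A N)).level ⊥ r.1)⟧ (z ⊥ r)) →
      ∀ w : HeightOneSpectrum (𝓞 ℚ), (∀ q ∈ r.1, q ≠ w) → ¬ W.HasGoodReductionAt w →
        ((primesEquiv w : Nat.Primes) : ℕ) ≠ 3 →
        (∃ Q : (W.baseChange (w.adicCompletion ℚ)).toAffine.Point, 3 • Q = 0 ∧ Q ≠ 0) →
        galoisCohomology.localization (W.torsionGaloisModule (((3 : ℕ) : ℤ) ^ j * ((3 : ℕ) : ℤ)))
          (Sum.inr w) 1 (Ψ κ) ∈ propagatedSelmerStructure W 3 j (Sum.inr w))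
    -- the per-level VALUE ROWS (T-PK6-VROW's OUT), displayed
    (hvalue : ∀ (j : ℕ) (σ : HeightOneSpectrum (𝓞 ℚ) → absoluteGaloisGroup ℚ),
      (∀ q, σ q ∈ (adicCompletionPrime ℚ q).inertia (absoluteGaloisGroup ℚ)) →
      (∀ q, modNCyclotomicCharacter ℚ (Ideal.absNorm q.asIdeal) (σ q) = η q) →
      ∀ (r : Finset (HeightOneSpectrum (𝓞 ℚ)))
        (hr : ∀ q ∈ r, q ∈ (cyclotomicLevelsRat 3 (badPlaces c d A N)).primes),
        (∀ q ∈ r, Kato.IsKolyvaginPrime W 3 (j + 1) ((primesEquiv q : Nat.Primes) : ℕ)) →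
        (∀ q ∈ r, Subgroup.zpowers (η q) = ⊤) →
        ∃ (s : ℤ_[3]) (u : (ZMod (3 ^ (j + 1)))ˣ)
          (ψ : (ℓ : ℕ) → (ZMod ℓ)ˣ →* Multiplicative (ZMod (3 ^ (j + 1)))),
          (∀ q ∈ r, Function.Surjective (ψ (Ideal.absNorm q.asIdeal))) ∧
          (∃ l ∈ cycIntLattice 3 (cycLevel 3 0 r),
            (((3 : ℕ) : ℤ_[3]) ^ (0 : ℕ)) • ((1 : ℚ_[3]) ⊗ₜ[ℚ]
              ((r.noncommProd 𝐃F⟦r, σ⟧ (ZetaValue.pairwise_commute_fieldDeriv (cycLevel 3 0 r)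
                  (fun ℓ => modNCyclotomicCharacter ℚ (cycLevel 3 0 r) (σ ℓ))
                  (fun ℓ => ((primesEquiv ℓ : Nat.Primes) : ℕ) - 1) r))
                (x 0 ⟨r, hr⟩ + sigma (cycLevel 3 0 r) (-1) (x 0 ⟨r, hr⟩)))) -
              ((s : ℚ_[3]) ⊗ₜ[ℚ] (1 : CyclotomicField (cycLevel 3 0 r) ℚ)) =
            (((3 : ℕ) : ℤ_[3]) ^ (j + 1)) • (l : ℚ_[3] ⊗[ℚ] CyclotomicField (cycLevel 3 0 r) ℚ)) ∧
          haveI : NeZero (∏ q ∈ r, Ideal.absNorm q.asIdeal) :=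
            ⟨Finset.prod_ne_zero_iff.2 fun q _ h => q.ne_bot (Ideal.absNorm_eq_zero_iff.1 h)⟩
          PadicInt.toZModPow (j + 1) s = (u : ZMod (3 ^ (j + 1))) *
            ((3 : ℕ) : ZMod (3 ^ (j + 1))) ^ (0 : ℕ) *
              kuriharaNumber P.f (3 ^ (j + 1)) (∏ q ∈ r, Ideal.absNorm q.asIdeal) ψ) :
    KatoKuriharaPortThreeAtWith₂ W 0 v₃ η P := by
  intro k k' D D' red hDW hDW' hkk' hred _hadd _hc3 hsurj _ht hv₃ _hcP _hper
  letI := TorsionCoeff.torsionBy.padicIntModule 3 (k + 1) (WeierstrassCurve.geomPoints W)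
  letI := TorsionCoeff.torsionBy.padicIntModule 3 (k' + 1) (WeierstrassCurve.geomPoints W)
  -- the guards
  obtain ⟨hT, hC, S, τ, hS, hτμ, hτq, hP⟩ := hDW
  obtain ⟨hT', hC', S', τ', hS', hτμ', hτq', hP'⟩ := hDW'
  have hirr : W.HasIrreducibleModPGaloisRep 3 :=
    hasIrreducibleModPGaloisRep_of_hasSurjectiveModNGaloisRep W 3 hsurj
  have hv₃p : ((primesEquiv v₃ : Nat.Primes) : ℕ) = 3 := primesEquiv_eq_of_natCast_mem Nat.prime_three hv₃
  -- Kolyvagin primes of the right levels (E1-deep on the classes of the guards)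
  have hKol : ∀ q ∈ D.primes, Kato.IsKolyvaginPrime W 3 (k + 1) ((primesEquiv q : Nat.Primes) : ℕ) :=
    fun q hq => KolyvaginPrime.isKolyvaginPrime_of_mem_frobeniusClassPrimes_of_le W
      (Nat.le_add_right k 0) (fun v hv => (hS v hv).1) hτμ hτq (hP hq)
  have hKol' : ∀ q ∈ D'.primes, Kato.IsKolyvaginPrime W 3 (k' + 1) ((primesEquiv q : Nat.Primes) : ℕ) :=
    fun q hq => KolyvaginPrime.isKolyvaginPrime_of_mem_frobeniusClassPrimes_of_le W
      (Nat.le_add_right k' 0) (fun v hv => (hS' v hv).1) hτμ' hτq' (hP' hq)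
  -- every Kolyvagin prime is a usable prime of Kato's system for `(c, d, A, N)`
  have husable : ∀ (j : ℕ) (q : HeightOneSpectrum (𝓞 ℚ)),
      Kato.IsKolyvaginPrime W 3 (j + 1) ((primesEquiv q : Nat.Primes) : ℕ) →
        q ∈ (cyclotomicLevelsRat 3 (badPlaces c d A N)).primes := by
    intro j q hq
    have hℓ := hq.prime
    have h13 : ((primesEquiv q : Nat.Primes) : ℕ) ≡ 1 [MOD 3] :=
      hq.modEq_one.of_dvd (dvd_pow_self 3 (Nat.succ_ne_zero j))
    refine (mem_primes_cyclotomicLevelsRat_badPlaces_iff 3 c d A N q).2 ⟨fun hdvd => ?_, hq.ne⟩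
    rcases (Nat.Prime.dvd_mul hℓ).mp hdvd with h | h
    · exact hcdA _ hℓ h13 h
    · apply hq.not_dvd
      rw [← hN]
      exact dvd_mul_of_dvd_left h 3
  have hPr : D.primes ⊆ (cyclotomicLevelsRat 3 (badPlaces c d A N)).primes :=
    fun q hq => husable k q (hKol q hq)
  have hPr' : D'.primes ⊆ (cyclotomicLevelsRat 3 (badPlaces c d A N)).primes :=
    fun q hq => husable k' q (hKol' q hq)
  -- `𝓕_can,3 = ⊤` at every depth (`t = 0`, Mazur–Rubin Lemma A.1 along the reduction tower)
  have htower : ∀ j : ℕ,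
      ∃ redj : (W.torsionGaloisModule (((3 : ℕ) : ℤ) ^ (j + 1) * ((3 : ℕ) : ℤ))).toContRepresentation →ⁱL
          (W.torsionGaloisModule (((3 : ℕ) : ℤ) ^ j * ((3 : ℕ) : ℤ))).toContRepresentation,
        ∀ y : geomTorsion W (((3 : ℕ) : ℤ) ^ (j + 1) * ((3 : ℕ) : ℤ)),
          ((redj y : geomTorsion W (((3 : ℕ) : ℤ) ^ j * ((3 : ℕ) : ℤ))) : geomPoints W) =
            ((3 : ℕ) : ℤ) • (y : geomPoints W) := by
    intro j
    obtain ⟨redj, hredj⟩ := exists_torsionReduction_three W j (j + 1)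
    refine ⟨redj, fun y => ?_⟩
    rw [hredj, Nat.add_sub_cancel_left, pow_one]
  choose redT hredT using htower
  have htop : ∀ (j : ℕ) (w : HeightOneSpectrum (𝓞 ℚ)), ((primesEquiv w : Nat.Primes) : ℕ) = 3 →
      propagatedSelmerStructure W 3 j (Sum.inr w) = ⊤ := by
    intro j w hw
    have hw3 : ((3 : ℕ) : 𝓞 ℚ) ∈ w.asIdeal := KolyvaginPrime.natCast_mem_asIdeal_of_primesEquiv_eq hw
    exact propagatedSelmerStructure_three_eq_top_of_torsion_eq_zero W w hw3 (ht0 w hw3) redT hredT j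
  -- the two coefficient systems `E[3^{j+1}]_{ℤ₃}` (GZ-2), reductions onto, pins `rfl`
  have hredk : Function.Surjective
      (tateModuleRed W 3 (W.continuous_galoisRepTate_holds 3) (k + 1)).hom := by
    intro y
    obtain ⟨b, hb⟩ := W.proj_surjective_of_isAlgClosed_holds 3 (k + 1) y.2
    exact ⟨b, Subtype.ext hb⟩
  have hredk' : Function.Surjective
      (tateModuleRed W 3 (W.continuous_galoisRepTate_holds 3) (k' + 1)).hom := by
    intro y
    obtain ⟨b, hb⟩ := W.proj_surjective_of_isAlgClosed_holds 3 (k' + 1) y.2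
    exact ⟨b, Subtype.ext hb⟩
  have hcompk : ∀ b : W.tateModule 3, tateToTorsion W 3 k b =
      (AddSubgroup.inclusion (geomTorsion_pow_succ_eq W 3 k).le : _ →+ _)
        ((tateModuleRed W 3 (W.continuous_galoisRepTate_holds 3) (k + 1)).hom b) := fun b =>
    Subtype.ext (by rw [coe_tateToTorsion_apply]; rfl)
  have hcompk' : ∀ b : W.tateModule 3, tateToTorsion W 3 k' b =
      (AddSubgroup.inclusion (geomTorsion_pow_succ_eq W 3 k').le : _ →+ _)
        ((tateModuleRed W 3 (W.continuous_galoisRepTate_holds 3) (k' + 1)).hom b) := fun b =>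
    Subtype.ext (by rw [coe_tateToTorsion_apply]; rfl)
  -- THEOREM D at the two depths with the displayed local clause (the seat's pair socket): ONE `σ`, (COMP)
  obtain ⟨σ, Φ, comm, κf, Φ'', comm'', κu, hσI, hσχ, hΦ, hΦ'', hKS, hKS', -, -, hres, hres', hcomp⟩ :=
    exists_isKolyvaginSystem_pair_propagatedSelmerStructure_of_localCondition W 3
      (badPlaces c d A N) (by decide) hkk' hbody.1
      (tateModuleRed W 3 (W.continuous_galoisRepTate_holds 3) (k + 1)) hredk
      (fun y => pow_smul_eq_zero 3 (k + 1) _ y)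
      (AddSubgroup.inclusion (geomTorsion_pow_succ_eq W 3 k).le : _ →+ _) continuous_of_discreteTopology
      (fun _ _ => rfl)
      (AddSubgroup.inclusion (geomTorsion_pow_succ_eq W 3 k).ge : _ →+ _) continuous_of_discreteTopology
      (fun y => Subtype.ext rfl) (fun y => Subtype.ext rfl) (fun _ => rfl)
      (tateModuleRed W 3 (W.continuous_galoisRepTate_holds 3) (k' + 1)) hredk'
      (fun y => pow_smul_eq_zero 3 (k' + 1) _ y)
      (AddSubgroup.inclusion (geomTorsion_pow_succ_eq W 3 k').le : _ →+ _) continuous_of_discreteTopology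
      (fun _ _ => rfl)
      (AddSubgroup.inclusion (geomTorsion_pow_succ_eq W 3 k').ge : _ →+ _) continuous_of_discreteTopology
      (fun y => Subtype.ext rfl) (fun y => Subtype.ext rfl) (fun _ => rfl)
      red hred hirr D hT D' hT' hC hC' hPr hPr' hKol hKol'
      (fun Ψ hΨ σ hσI hσχ r hr comm κ hκ w hw hbad hwp hanom =>
        hloc k (tateModuleRed W 3 (W.continuous_galoisRepTate_holds 3) (k + 1))
          (AddSubgroup.inclusion (geomTorsion_pow_succ_eq W 3 k).le : _ →+ _)
          continuous_of_discreteTopology (fun _ _ => rfl) hcompk Ψ hΨ σ hσI hσχ r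
          (fun q hq => hKol q (hr (Finset.mem_coe.2 hq))) comm κ hκ w hw hbad hwp hanom)
      (fun Ψ hΨ σ hσI hσχ r hr comm κ hκ w hw hbad hwp hanom =>
        hloc k' (tateModuleRed W 3 (W.continuous_galoisRepTate_holds 3) (k' + 1))
          (AddSubgroup.inclusion (geomTorsion_pow_succ_eq W 3 k').le : _ →+ _)
          continuous_of_discreteTopology (fun _ _ => rfl) hcompk' Ψ hΨ σ hσI hσχ r
          (fun q hq => hKol' q (hr (Finset.mem_coe.2 hq))) comm κ hκ w hw hbad hwp hanom)
      (htop k) (htop k')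
  refine ⟨κf, Λfin k, κf, κu, Λfin k', κu, ?_, ?_, fun e he' he => ⟨hcomp e he he', hcomp e he he'⟩⟩
  · -- depth `k`: (0), (I4) with `κ′ = κ`, (Λ) from the rider, (DICT3) per level from T-PK6-GEN
    refine ⟨fun e he => hKS.mem_selmerGroup e he,
      ⟨hKS, fun e _ => by rw [sub_self]; exact zero_mem _⟩, (hfin k).1, (hfin k).2.1, fun r hr => ?_⟩
    obtain ⟨s, u, ψ, hψ, hval, hw⟩ := hvalue k σ hσI hσχ r
      (fun q hq => hPr (hr (Finset.mem_coe.2 hq))) (fun q hq => hKol q (hr (Finset.mem_coe.2 hq)))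
      (fun q hq => hC.zpowers_eq_top (hr (Finset.mem_coe.2 hq)))
    obtain ⟨u', hu'⟩ := KatoValue.GeneralLevel.exists_unit_apply_localization_eq_of_derivativeFamily W 3
      P.f ι κK Λ c d a A z x (by decide) hbody (hfin k)
      (tateModuleRed W 3 (W.continuous_galoisRepTate_holds 3) (k + 1))
      (AddSubgroup.inclusion (geomTorsion_pow_succ_eq W 3 k).le : _ →+ _) continuous_of_discreteTopology
      (fun _ _ => rfl) (fun _ => rfl) D hPr σ Φ comm κf hΦ hKS hres hv₃p r hr s hval u hw
    exact ⟨u', ψ, hψ, hu'⟩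
  · -- depth `k′`: the same
    refine ⟨fun e he => hKS'.mem_selmerGroup e he,
      ⟨hKS', fun e _ => by rw [sub_self]; exact zero_mem _⟩, (hfin k').1, (hfin k').2.1, fun r hr => ?_⟩
    obtain ⟨s, u, ψ, hψ, hval, hw⟩ := hvalue k' σ hσI hσχ r
      (fun q hq => hPr' (hr (Finset.mem_coe.2 hq))) (fun q hq => hKol' q (hr (Finset.mem_coe.2 hq)))
      (fun q hq => hC'.zpowers_eq_top (hr (Finset.mem_coe.2 hq)))
    obtain ⟨u', hu'⟩ := KatoValue.GeneralLevel.exists_unit_apply_localization_eq_of_derivativeFamily W 3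
      P.f ι κK Λ c d a A z x (by decide) hbody (hfin k')
      (tateModuleRed W 3 (W.continuous_galoisRepTate_holds 3) (k' + 1))
      (AddSubgroup.inclusion (geomTorsion_pow_succ_eq W 3 k').le : _ →+ _) continuous_of_discreteTopology
      (fun _ _ => rfl) (fun _ => rfl) D' hPr' σ Φ'' comm'' κu hΦ'' hKS' hres' hv₃p r hr s hval u hw
    exact ⟨u', ψ, hψ, hu'⟩

/-- **The same END with the value rows discharged** (★ PK-6₂ ∘ T-PK6-VDIS with `hbad` replaced by
`hloc`): PORT″ `KatoKuriharaPortThreeAtWith₂ W 0 v₃ η P` from `ZetaBody` (displayed `hbody`), the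
riders `hfin`, `hcdA`, THEOREM D's `ht0`, the displayed local clause `hloc`, and the level-free VALUE
certificates of n1011-p02's T-PK6-VDIS (`hirr`, `hNorm`/`hκ0`, `d′`/`hcd`/`hdd′`, `hAN`, `hpN`,
`aM`/`haM`, `hE0`/`hE`, `hR0`/`hR`) via `ValueRow.valueRows_of_zetaBody` (`hf := P.isNewformOf`).
[cite: Kato2004Asterisque, §9.4 (p. 188), Thm. 9.7 (p. 189), Thm. 6.6 (1) (p. 163) and Ex. 13.3 (pp. 224–225)]
[cite: Kim2022StructureSelmer, Thm. 3.13 and its proof (arXiv v3 pp. 12, 26–28)]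
[cite: MazurRubin2004, Thm. 3.2.4 and App. A (Prop. A.2, Remark A.5)] [cite: Rubin2000, Thm. 4.5.1] -/
theorem katoKuriharaPortThreeAtWith₂_zero_of_zetaBody_of_localCondition_of_valueRows
    {N : ℕ} [NeZero N] (P : ModularParametrizationData W N) (hN : N = W.conductorNorm ℤ)
    {ι : (n : ℕ) → (CyclotomicField n ℚ →+* ℂ)} {κK : ℝ}
    {Λ : ∀ (k' : ℕ) (r : Finset (HeightOneSpectrum (𝓞 ℚ))),
      H1 (tateRep W 3) (cycSubgroup 3 k' r) →ₗ[ℤ_[3]] ℚ_[3] ⊗[ℚ] CyclotomicField (cycLevel 3 k' r) ℚ}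
    {c d a : ℤ} {A : ℕ} [NeZero A]
    {z : ∀ (k' : ℕ) (r : (cyclotomicLevelsRat 3 (badPlaces c d A N)).Ideals),
      H1 (tateRep W 3) ((cyclotomicLevelsRat 3 (badPlaces c d A N)).level k' r.1)}
    {x : ∀ (k' : ℕ) (r : (cyclotomicLevelsRat 3 (badPlaces c d A N)).Ideals),
      CyclotomicField (cycLevel 3 k' r.1) ℚ}
    (hbody : ZetaBody W 3 P.f ι κK Λ c d a A z x)
    {v₃ : HeightOneSpectrum (𝓞 ℚ)}
    (Λfin : ∀ j : ℕ, galoisCohomology ((W.torsionGaloisModule (((3 : ℕ) : ℤ) ^ j * ((3 : ℕ) : ℤ))).toLocal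
      (Sum.inr v₃)) 1 →+ ZMod (3 ^ (j + 1)))
    (hfin : ∀ j : ℕ, KatoExpStarFiniteLevelAt W 3 j 0 v₃ Λ (Λfin j))
    {η : (q : HeightOneSpectrum (𝓞 ℚ)) → (ZMod (Ideal.absNorm q.asIdeal))ˣ}
    (hcdA : ∀ q : ℕ, q.Prime → q ≡ 1 [MOD 3] → ¬ q ∣ 2 * c.natAbs * d.natAbs * A)
    (ht0 : ∀ w : HeightOneSpectrum (𝓞 ℚ), ((3 : ℕ) : 𝓞 ℚ) ∈ w.asIdeal →
        ∀ Q : (W.baseChange (w.adicCompletion ℚ)).toAffine.Point, 3 • Q = 0 → Q = 0)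
    -- the DISPLAYED local clause at the ANOMALOUS bad places, every depth `j` ([Ru00] Thm. 4.5.1 read)
    (hloc : ∀ (j : ℕ) {M' : Type} [AddCommGroup M'] [Module ℤ_[3] M'] [TopologicalSpace M']
        [DiscreteTopology M'] [IsTopologicalAddGroup M'] [ContinuousSMul ℤ_[3] M']
        {T' : GaloisRep ℚ ℤ_[3] M'} (red : (T∞).toTopRep ⟶ T'.toTopRep)
        (e : M' →+ WeierstrassCurve.geomTorsion W (((3 : ℕ) : ℤ) ^ j * ((3 : ℕ) : ℤ))),
        Continuous e →
        (∀ (g : absoluteGaloisGroup ℚ) (y : M'), e (T'.toTopRep.ρ g y) =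
          (W.torsionGaloisModule (((3 : ℕ) : ℤ) ^ j * ((3 : ℕ) : ℤ))).toTopRep.ρ g (e y)) →
        (∀ b : W.tateModule 3, tateToTorsion W 3 j b = e (red.hom b)) →
      ∀ (Ψ : continuousCohomology 1 T'.toTopRep →+
        galoisCohomology (W.torsionGaloisModule (((3 : ℕ) : ℤ) ^ j * ((3 : ℕ) : ℤ))) 1),
      (∀ (φ : contOneCocycles T'.toTopRep)
        (ψ : contOneCocycles (W.torsionGaloisModule (((3 : ℕ) : ℤ) ^ j * ((3 : ℕ) : ℤ))).toTopRep),
        (∀ g, ψ.1 g = e (φ.1 g)) → Ψ (oneCocycleClass _ φ) = oneCocycleClass _ ψ) →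
      ∀ (σ : HeightOneSpectrum (𝓞 ℚ) → absoluteGaloisGroup ℚ),
        (∀ ℓ, σ ℓ ∈ (adicCompletionPrime ℚ ℓ).inertia (absoluteGaloisGroup ℚ)) →
        (∀ ℓ, modNCyclotomicCharacter ℚ (Ideal.absNorm ℓ.asIdeal) (σ ℓ) = η ℓ) →
      ∀ (r : (cyclotomicLevelsRat 3 (badPlaces c d A N)).Ideals),
        (∀ q ∈ r.1, Kato.IsKolyvaginPrime W 3 (j + 1) ((primesEquiv q : Nat.Primes) : ℕ)) →
      ∀ (comm : ((r.1 : Finset _) : Set (HeightOneSpectrum (𝓞 ℚ))).Pairwise fun a b =>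
          Commute (𝐃⟦ℤ_[3], T'.toTopRep, ((cyclotomicLevelsRat 3 (badPlaces c d A N)).level ⊥ r.1), σ⟧ a)
            (𝐃⟦ℤ_[3], T'.toTopRep, ((cyclotomicLevelsRat 3 (badPlaces c d A N)).level ⊥ r.1), σ⟧ b))
        (κ : continuousCohomology 1 T'.toTopRep),
        resSubgroup T'.toTopRep ((cyclotomicLevelsRat 3 (badPlaces c d A N)).level ⊥ r.1) 1 κ =
          (r.1.noncommProd 𝐃⟦ℤ_[3], T'.toTopRep,
              ((cyclotomicLevelsRat 3 (badPlaces c d A N)).level ⊥ r.1), σ⟧ comm)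
            (𝐫⟦red, T', ((cyclotomicLevelsRat 3 (badPlaces c d A N)).level ⊥ r.1)⟧ (z ⊥ r)) →
      ∀ w : HeightOneSpectrum (𝓞 ℚ), (∀ q ∈ r.1, q ≠ w) → ¬ W.HasGoodReductionAt w →
        ((primesEquiv w : Nat.Primes) : ℕ) ≠ 3 →
        (∃ Q : (W.baseChange (w.adicCompletion ℚ)).toAffine.Point, 3 • Q = 0 ∧ Q ≠ 0) →
        galoisCohomology.localization (W.torsionGaloisModule (((3 : ℕ) : ℤ) ^ j * ((3 : ℕ) : ℤ)))
          (Sum.inr w) 1 (Ψ κ) ∈ propagatedSelmerStructure W 3 j (Sum.inr w))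
    -- the VALUE certificates (T-PK6-VDIS), replacing the displayed `hvalue`
    (hirr : W.HasIrreducibleModPGaloisRep 3)
    (hNorm : ∃ u : ℚ, (u : ℝ) = κK ∧ padicValRat 3 u = 0) (hκ0 : κK ≠ 0)
    (d' : ℤ) (hcd : Int.gcd (c * d) A = 1) (hdd' : d * d' ≡ 1 [ZMOD (A : ℤ)])
    (hAN : Nat.Coprime A N) (hpN : 3 ^ 2 ∣ N)
    (aM : ℕ → ℤ) (haM : ∀ q ∈ (3 * A).primeFactors, cuspCoeff P.f q = aM q)
    (hE0 : ∏ q ∈ (3 * A).primeFactors, (1 - (aM q : ℚ) / q + (if q ∣ N then 0 else (1 / q : ℚ))) ≠ 0)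
    (hE : padicValRat 3
      (∏ q ∈ (3 * A).primeFactors, (1 - (aM q : ℚ) / q + (if q ∣ N then 0 else (1 / q : ℚ)))) = 0)
    (hR0 : (c : ℚ) ^ 2 * (d : ℚ) ^ 2 * ratMinusSymbol P.f ((a : ℚ) / A) -
        (c : ℚ) * (d : ℚ) ^ 2 * ratMinusSymbol P.f ((a * c : ℚ) / A) -
        (c : ℚ) ^ 2 * (d : ℚ) * ratMinusSymbol P.f ((a * d' : ℚ) / A) +
        (c : ℚ) * (d : ℚ) * ratMinusSymbol P.f ((a * c * d' : ℚ) / A) ≠ 0)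
    (hR : padicValRat 3 ((c : ℚ) ^ 2 * (d : ℚ) ^ 2 * ratMinusSymbol P.f ((a : ℚ) / A) -
        (c : ℚ) * (d : ℚ) ^ 2 * ratMinusSymbol P.f ((a * c : ℚ) / A) -
        (c : ℚ) ^ 2 * (d : ℚ) * ratMinusSymbol P.f ((a * d' : ℚ) / A) +
        (c : ℚ) * (d : ℚ) * ratMinusSymbol P.f ((a * c * d' : ℚ) / A)) = 0) :
    KatoKuriharaPortThreeAtWith₂ W 0 v₃ η P :=
  katoKuriharaPortThreeAtWith₂_zero_of_zetaBody_of_localCondition W P hN hbody Λfin hfin hcdA ht0 hloc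
    (ValueRow.valueRows_of_zetaBody hbody P.isNewformOf (by decide) hirr hNorm hκ0 d' hcd hdd' hAN hpN
      aM haM hE0 hE hR0 hR η)

end Summit.BirchSwinnertonDyer.BirchSwinnertonDyer.Theorems.KimAtThreePortSharedC3End

end
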